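import Mathlib
import Summits.CriticalPhenomena.Ising3DConformalLimit.Theses.GaussianScaleMixture

/-!
# `GSMSchurOrder` — Schur order of a Gaussian scale mixture on Euclidean lattice spheres

Route `GaussianScaleMixture` of `Ising3DConformalLimit`, item `stmt-CriticalPhenomena-8370`
(support; a dividend of the crux `CriticalTwoPointGSM`).

If the critical two-point function is a Gaussian scale mixture
`⟨σ₀σ_x⟩ = ∫ exp (-∑ sᵢ xᵢ²) ν(ds)` with `ν` an exchangeable probability measure carried by the
closed octant, then the Laplace functional `F u = ∫ exp (-∑ sᵢ uᵢ) ν(ds)` is convex and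
permutation-symmetric on the nonnegative orthant, hence Schur-convex there
(Marshall–Olkin–Arnold, *Inequalities: Theory of Majorization*, Ch. 3, Prop. C.2). For three
coordinates with equal sums the hypotheses `max yᵢ² ≤ max xᵢ²` and `min xᵢ² ≤ min yᵢ²` are exactly
the majorisation `x² ≻ y²`, which is realised by two transfers (Hardy–Littlewood–Pólya), so
`⟨σ₀σ_y⟩ = F (y²) ≤ F (x²) = ⟨σ₀σ_x⟩`.

Contents:
* `le_of_transfer` — a symmetric convex function does not increase under a transfer
  (the transferred vector lies on the segment `[u, u ∘ swap i j]`);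
* `schur_three_sorted`, `schur_three` — the three-variable Hardy–Littlewood–Pólya step;
* `integrable_exp_neg_sum_mul`, `integral_exp_neg_sum_mul_comp_perm`,
  `convexOn_integral_exp_neg_sum_mul` — integrability, permutation symmetry and convexity of the
  Laplace functional of an exchangeable finite measure on the octant;
* `gsmSchurOrder_proof : GSMSchurOrder` — the closing theorem.

No new definitions are introduced (the orthant and the Laplace functional are written inline);
the helper lemmas live in the sub-namespace `…Theorems.GSMSchurOrder`.
-/

namespace Summit.CriticalPhenomena.Ising3DConformalLimit.Theorems

open MeasureTheory

namespace GSMSchurOrder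

section Transfer

variable {ι : Type*} [DecidableEq ι]

/-- **Transfer lemma** (one Hardy–Littlewood–Pólya step). Let `φ` be convex on a
permutation-invariant convex set `S ⊆ ℝ^ι` and symmetric under permutations of the coordinates.
If `v` is obtained from `u ∈ S` by moving mass from coordinate `i` down to coordinate `j` without
overshooting (`u j ≤ v i ≤ u i`, `v i + v j = u i + u j`, all other coordinates unchanged), then
`v ∈ S` and `φ v ≤ φ u` (no hypothesis `i ≠ j` is needed: for `i = j` the data force `v = u`). Proof: `v = t • u + (1 - t) • (u ∘ swap i j)` with
`t = (v i - u j) / (u i - u j) ∈ [0, 1]`, and `φ (u ∘ swap i j) = φ u`. -/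
theorem le_of_transfer {S : Set (ι → ℝ)} {φ : (ι → ℝ) → ℝ} (hφ : ConvexOn ℝ S φ)
    (hS : ∀ σ : Equiv.Perm ι, ∀ u ∈ S, u ∘ σ ∈ S)
    (hsymm : ∀ σ : Equiv.Perm ι, ∀ u ∈ S, φ (u ∘ σ) = φ u)
    {u v : ι → ℝ} (hu : u ∈ S) {i j : ι}
    (hk : ∀ k, k ≠ i → k ≠ j → v k = u k) (hsum : v i + v j = u i + u j)
    (hji : u j ≤ v i) (hvi : v i ≤ u i) : v ∈ S ∧ φ v ≤ φ u := by
  rcases eq_or_lt_of_le (hji.trans hvi) with h | h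
  · -- degenerate case `u j = u i`: then `v = u`
    have hvi' : v i = u i := le_antisymm hvi (by rw [← h]; exact hji)
    have hvj' : v j = u j := by linarith
    have hv : v = u := by
      funext k
      by_cases hki : k = i
      · rw [hki]; exact hvi'
      · by_cases hkj : k = j
        · rw [hkj]; exact hvj'
        · exact hk k hki hkj
    rw [hv]
    exact ⟨hu, le_rfl⟩
  · -- generic case `u j < u i`
    have hdpos : 0 < u i - u j := by linarith
    set t : ℝ := (v i - u j) / (u i - u j) with ht
    have ht0 : 0 ≤ t := div_nonneg (by linarith) hdpos.le
    have ht1 : t ≤ 1 := div_le_one_of_le₀ (by linarith) hdpos.le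
    have htd : t * (u i - u j) = v i - u j := by
      rw [ht]; field_simp
    have hu' : u ∘ Equiv.swap i j ∈ S := hS _ u hu
    have hv : t • u + (1 - t) • (u ∘ Equiv.swap i j) = v := by
      funext k
      simp only [Pi.add_apply, Pi.smul_apply, Function.comp_apply, smul_eq_mul]
      by_cases hki : k = i
      · rw [hki, Equiv.swap_apply_left]
        linear_combination htd
      · by_cases hkj : k = j
        · rw [hkj, Equiv.swap_apply_right]
          linear_combination -hsum - htd
        · rw [Equiv.swap_apply_of_ne_of_ne hki hkj, hk k hki hkj]
          ring
    refine ⟨?_, ?_⟩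
    · rw [← hv]
      exact hφ.1 hu hu' ht0 (by linarith) (by ring)
    · have key := hφ.2 hu hu' ht0 (by linarith : (0 : ℝ) ≤ 1 - t) (by ring)
      rw [hv, hsymm _ u hu] at key
      simp only [smul_eq_mul] at key
      calc φ v ≤ t * φ u + (1 - t) * φ u := key
        _ = φ u := by ring

end Transfer

section SchurThree

variable {S : Set (Fin 3 → ℝ)} {φ : (Fin 3 → ℝ) → ℝ}

/-- **Hardy–Littlewood–Pólya for three sorted coordinates.** If `φ` is convex on a
permutation-invariant convex set `S ⊆ ℝ³` and permutation-symmetric, `a b ∈ S` are both sorted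
increasingly, have the same sum, `b 2 ≤ a 2` and `a 0 ≤ b 0` (i.e. `a ≻ b`), then `φ b ≤ φ a`:
`b` is reached from `a` by two transfers (`le_of_transfer`). -/
theorem schur_three_sorted (hφ : ConvexOn ℝ S φ)
    (hS : ∀ σ : Equiv.Perm (Fin 3), ∀ u ∈ S, u ∘ σ ∈ S)
    (hsymm : ∀ σ : Equiv.Perm (Fin 3), ∀ u ∈ S, φ (u ∘ σ) = φ u)
    {a b : Fin 3 → ℝ} (ha : a ∈ S) (hamono : Monotone a) (hbmono : Monotone b)
    (hsum : a 0 + a 1 + a 2 = b 0 + b 1 + b 2) (hmax : b 2 ≤ a 2) (hmin : a 0 ≤ b 0) :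
    φ b ≤ φ a := by
  have ha01 : a 0 ≤ a 1 := hamono (by decide)
  have ha12 : a 1 ≤ a 2 := hamono (by decide)
  have hb01 : b 0 ≤ b 1 := hbmono (by decide)
  have hb12 : b 1 ≤ b 2 := hbmono (by decide)
  rcases le_or_gt (b 1) (a 1) with h1 | h1
  · -- transfer 1 ↘ 0 down to `b 1`, then 2 ↘ 0
    obtain ⟨c, hc0, hc1, hc2⟩ : ∃ c : Fin 3 → ℝ, c 0 = a 0 + a 1 - b 1 ∧ c 1 = b 1 ∧ c 2 = a 2 :=
      ⟨![a 0 + a 1 - b 1, b 1, a 2], rfl, rfl, rfl⟩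
    obtain ⟨hcS, hca⟩ := le_of_transfer hφ hS hsymm ha (i := 1) (j := 0) (v := c)
      (by intro k hk1 hk0; fin_cases k <;> simp_all) (by rw [hc0, hc1]; ring)
      (by rw [hc1]; linarith) (by rw [hc1]; exact h1)
    obtain ⟨-, hbc⟩ := le_of_transfer hφ hS hsymm hcS (i := 2) (j := 0) (v := b)
      (by intro k hk2 hk0; fin_cases k <;> simp_all) (by rw [hc2, hc0]; linarith)
      (by rw [hc0]; linarith) (by rw [hc2]; exact hmax)
    exact hbc.trans hca
  · -- transfer 2 ↘ 1 up to `b 1`, then 2 ↘ 0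
    obtain ⟨c, hc0, hc1, hc2⟩ : ∃ c : Fin 3 → ℝ, c 0 = a 0 ∧ c 1 = b 1 ∧ c 2 = a 2 + a 1 - b 1 :=
      ⟨![a 0, b 1, a 2 + a 1 - b 1], rfl, rfl, rfl⟩
    obtain ⟨hcS, hca⟩ := le_of_transfer hφ hS hsymm ha (i := 2) (j := 1) (v := c)
      (by intro k hk2 hk1; fin_cases k <;> simp_all) (by rw [hc2, hc1]; ring)
      (by rw [hc2]; linarith) (by rw [hc2]; linarith)
    obtain ⟨-, hbc⟩ := le_of_transfer hφ hS hsymm hcS (i := 2) (j := 0) (v := b)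
      (by intro k hk2 hk0; fin_cases k <;> simp_all) (by rw [hc2, hc0]; linarith)
      (by rw [hc0]; linarith) (by rw [hc2]; linarith)
    exact hbc.trans hca

/-- **Schur-convexity on `ℝ³`, unsorted form.** If `φ` is convex on a permutation-invariant
convex set `S ⊆ ℝ³` and permutation-symmetric, and `a b ∈ S` have equal sums with
`max b ≤ max a` (`∀ i, ∃ j, b i ≤ a j`) and `min a ≤ min b` (`∀ i, ∃ j, a j ≤ b i`) — for three
coordinates this is the majorisation `a ≻ b` — then `φ b ≤ φ a`
(Marshall–Olkin–Arnold, Ch. 3, Prop. C.2, case `n = 3`). -/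
theorem schur_three (hφ : ConvexOn ℝ S φ)
    (hS : ∀ σ : Equiv.Perm (Fin 3), ∀ u ∈ S, u ∘ σ ∈ S)
    (hsymm : ∀ σ : Equiv.Perm (Fin 3), ∀ u ∈ S, φ (u ∘ σ) = φ u)
    {a b : Fin 3 → ℝ} (ha : a ∈ S) (hb : b ∈ S)
    (hsum : ∑ i, a i = ∑ i, b i) (hmax : ∀ i, ∃ j, b i ≤ a j) (hmin : ∀ i, ∃ j, a j ≤ b i) :
    φ b ≤ φ a := by
  obtain ⟨σ, hamono⟩ : ∃ σ : Equiv.Perm (Fin 3), Monotone (a ∘ σ) := ⟨_, Tuple.monotone_sort a⟩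
  obtain ⟨τ, hbmono⟩ : ∃ τ : Equiv.Perm (Fin 3), Monotone (b ∘ τ) := ⟨_, Tuple.monotone_sort b⟩
  have hle2 : ∀ k : Fin 3, k ≤ 2 := by decide
  have h0le : ∀ k : Fin 3, 0 ≤ k := by decide
  rw [← hsymm σ a ha, ← hsymm τ b hb]
  refine schur_three_sorted hφ hS hsymm (hS σ a ha) hamono hbmono ?_ ?_ ?_
  · have h1 : ∑ i, a (σ i) = ∑ i, a i := Equiv.sum_comp σ a
    have h2 : ∑ i, b (τ i) = ∑ i, b i := Equiv.sum_comp τ b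
    simp only [Fin.sum_univ_three] at h1 h2 hsum
    simp only [Function.comp_apply]
    linarith
  · obtain ⟨j, hj⟩ := hmax (τ 2)
    calc (b ∘ τ) 2 = b (τ 2) := rfl
      _ ≤ a j := hj
      _ = (a ∘ σ) (σ.symm j) := by simp
      _ ≤ (a ∘ σ) 2 := hamono (hle2 _)
  · obtain ⟨j, hj⟩ := hmin (τ 0)
    calc (a ∘ σ) 0 ≤ (a ∘ σ) (σ.symm j) := hamono (h0le _)
      _ = a j := by simp
      _ ≤ b (τ 0) := hj
      _ = (b ∘ τ) 0 := rfl

end SchurThree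

section Laplace

variable {ι : Type*} [Fintype ι]

/-- For a finite measure `ν` on `ℝ^ι` carried by the closed nonnegative orthant and `u` in the
orthant, the Gaussian-scale-mixture integrand `s ↦ exp (-∑ sᵢ uᵢ)` is `ν`-integrable (it is
continuous and `ν`-a.e. bounded by `1`). -/
theorem integrable_exp_neg_sum_mul (ν : Measure (ι → ℝ)) [IsFiniteMeasure ν]
    (hν : ν {s | ∃ i, s i < 0} = 0) {u : ι → ℝ} (hu : ∀ i, 0 ≤ u i) :
    Integrable (fun s => Real.exp (-∑ i, s i * u i)) ν := by
  have hae : ∀ᵐ s ∂ν, ∀ i, 0 ≤ s i := by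
    filter_upwards [measure_eq_zero_iff_ae_notMem.1 hν] with s hs
    simpa using hs
  refine Integrable.mono' (integrable_const (1 : ℝ)) ?_ ?_
  · exact (Continuous.aestronglyMeasurable (by fun_prop))
  · filter_upwards [hae] with s hs
    rw [Real.norm_eq_abs, abs_of_pos (Real.exp_pos _), Real.exp_le_one_iff]
    have : 0 ≤ ∑ i, s i * u i := Finset.sum_nonneg fun i _ => mul_nonneg (hs i) (hu i)
    linarith

/-- Permutation symmetry of the Laplace functional of an exchangeable measure:
if `ν.map (· ∘ σ) = ν` for every permutation `σ` of the coordinates, then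
`∫ exp (-∑ sᵢ u_{σ i}) dν = ∫ exp (-∑ sᵢ uᵢ) dν`. -/
theorem integral_exp_neg_sum_mul_comp_perm (ν : Measure (ι → ℝ))
    (hexch : ∀ σ : Equiv.Perm ι, ν.map (fun s : ι → ℝ => s ∘ σ) = ν)
    (σ : Equiv.Perm ι) (u : ι → ℝ) :
    ∫ s, Real.exp (-∑ i, s i * (u ∘ σ) i) ∂ν = ∫ s, Real.exp (-∑ i, s i * u i) ∂ν := by
  have hmeas : Measurable (fun s : ι → ℝ => s ∘ σ.symm) :=
    measurable_pi_lambda _ (fun i => measurable_pi_apply _)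
  have h1 : ∀ s : ι → ℝ, ∑ i, s i * (u ∘ σ) i = ∑ i, (s ∘ σ.symm) i * u i := by
    intro s
    rw [← Equiv.sum_comp σ.symm (fun i => s i * (u ∘ σ) i)]
    simp only [Function.comp_apply, Equiv.apply_symm_apply]
  simp_rw [h1]
  have h2 := integral_map (μ := ν) hmeas.aemeasurable
    (f := fun s' : ι → ℝ => Real.exp (-∑ i, s' i * u i))
    (Continuous.aestronglyMeasurable (by fun_prop))
  rw [hexch σ.symm] at h2
  rw [h2]

/-- Convexity of the Laplace functional `u ↦ ∫ exp (-∑ sᵢ uᵢ) dν` on the nonnegative orthant,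
for a finite measure `ν` carried by the closed octant: the integrand is a mixture of
`exp ∘ (linear)`, each convex, and the integral is monotone. -/
theorem convexOn_integral_exp_neg_sum_mul (ν : Measure (ι → ℝ)) [IsFiniteMeasure ν]
    (hν : ν {s | ∃ i, s i < 0} = 0) :
    ConvexOn ℝ {u : ι → ℝ | ∀ i, 0 ≤ u i} (fun u => ∫ s, Real.exp (-∑ i, s i * u i) ∂ν) := by
  have hmem : ∀ x ∈ {u : ι → ℝ | ∀ i, 0 ≤ u i}, ∀ y ∈ {u : ι → ℝ | ∀ i, 0 ≤ u i}, ∀ a b : ℝ,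
      0 ≤ a → 0 ≤ b → a • x + b • y ∈ {u : ι → ℝ | ∀ i, 0 ≤ u i} := by
    intro x hx y hy a b ha hb i
    simp only [Pi.add_apply, Pi.smul_apply, smul_eq_mul]
    exact add_nonneg (mul_nonneg ha (hx i)) (mul_nonneg hb (hy i))
  refine ⟨fun x hx y hy a b ha hb _ => hmem x hx y hy a b ha hb, ?_⟩
  intro x hx y hy a b ha hb hab
  have hIx := integrable_exp_neg_sum_mul ν hν hx
  have hIy := integrable_exp_neg_sum_mul ν hν hy
  have hIxy := integrable_exp_neg_sum_mul ν hν (hmem x hx y hy a b ha hb)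
  simp only [smul_eq_mul]
  calc ∫ s, Real.exp (-∑ i, s i * (a • x + b • y) i) ∂ν
      ≤ ∫ s, (a * Real.exp (-∑ i, s i * x i) + b * Real.exp (-∑ i, s i * y i)) ∂ν := by
        refine integral_mono hIxy ((hIx.const_mul a).add (hIy.const_mul b)) fun s => ?_
        have hlin : ∑ i, s i * (a • x + b • y) i = a * ∑ i, s i * x i + b * ∑ i, s i * y i := by
          simp only [Pi.add_apply, Pi.smul_apply, smul_eq_mul]
          rw [Finset.mul_sum, Finset.mul_sum, ← Finset.sum_add_distrib]
          exact Finset.sum_congr rfl fun i _ => by ring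
        have hexp := convexOn_exp.2 (Set.mem_univ (-∑ i, s i * x i))
          (Set.mem_univ (-∑ i, s i * y i)) ha hb hab
        simp only [smul_eq_mul] at hexp
        dsimp only
        rw [hlin]
        calc Real.exp (-(a * ∑ i, s i * x i + b * ∑ i, s i * y i))
            = Real.exp (a * -∑ i, s i * x i + b * -∑ i, s i * y i) := by ring_nf
          _ ≤ a * Real.exp (-∑ i, s i * x i) + b * Real.exp (-∑ i, s i * y i) := hexp
    _ = a * ∫ s, Real.exp (-∑ i, s i * x i) ∂ν + b * ∫ s, Real.exp (-∑ i, s i * y i) ∂ν := by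
        rw [integral_add (hIx.const_mul a) (hIy.const_mul b), integral_const_mul,
          integral_const_mul]

end Laplace

end GSMSchurOrder

open GSMSchurOrder in
/-- **`GSMSchurOrder` (item stmt-CriticalPhenomena-8370).** If the critical two-point function of
the n.n. Ising model on `ℤ³` is a Gaussian scale mixture with an exchangeable mixing probability
measure on the closed octant (`CriticalTwoPointGSM`), then for lattice points `x y ∈ ℤ³` on a
common Euclidean sphere (`∑ xᵢ² = ∑ yᵢ²`) with `max yᵢ² ≤ max xᵢ²` and `min xᵢ² ≤ min yᵢ²` (i.e.
`x² ≻ y²`) one has `⟨σ₀σ_y⟩ ≤ ⟨σ₀σ_x⟩`; e.g. `G(2,2,1) ≤ G(3,0,0)`, `G(3,2,2) ≤ G(4,1,0)`.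
Proof: Schur-convexity (`schur_three`) of the convex, permutation-symmetric Laplace functional
`u ↦ ∫ exp (-∑ sᵢ uᵢ) dν` on the orthant, evaluated at `u = x²` and `u = y²`. -/
theorem gsmSchurOrder_proof :
    Summit.CriticalPhenomena.Ising3DConformalLimit.Theses.GaussianScaleMixture.GSMSchurOrder := by
  unfold Summit.CriticalPhenomena.Ising3DConformalLimit.Theses.GaussianScaleMixture.GSMSchurOrder
  intro hG x y hsum hmax hmin
  obtain ⟨ν, hprob, hν0, hexch, hrep⟩ := hG
  rw [hrep x, hrep y]
  have hS : ∀ σ : Equiv.Perm (Fin 3), ∀ u ∈ {u : Fin 3 → ℝ | ∀ i, 0 ≤ u i},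
      u ∘ σ ∈ {u : Fin 3 → ℝ | ∀ i, 0 ≤ u i} := fun σ u hu i => hu (σ i)
  have hsymm : ∀ σ : Equiv.Perm (Fin 3), ∀ u ∈ {u : Fin 3 → ℝ | ∀ i, 0 ≤ u i},
      (fun u => ∫ s, Real.exp (-∑ i, s i * u i) ∂ν) (u ∘ σ)
        = (fun u => ∫ s, Real.exp (-∑ i, s i * u i) ∂ν) u :=
    fun σ u _ => integral_exp_neg_sum_mul_comp_perm ν hexch σ u
  have hsum' : ∑ i, ((x i : ℝ)) ^ 2 = ∑ i, ((y i : ℝ)) ^ 2 := by exact_mod_cast hsum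
  have hmax' : ∀ i, ∃ j, ((y i : ℝ)) ^ 2 ≤ ((x j : ℝ)) ^ 2 :=
    fun i => (hmax i).imp fun j hj => by exact_mod_cast hj
  have hmin' : ∀ i, ∃ j, ((x j : ℝ)) ^ 2 ≤ ((y i : ℝ)) ^ 2 :=
    fun i => (hmin i).imp fun j hj => by exact_mod_cast hj
  exact schur_three (convexOn_integral_exp_neg_sum_mul ν hν0) hS hsymm
    (a := fun i => ((x i : ℝ)) ^ 2) (b := fun i => ((y i : ℝ)) ^ 2)
    (fun i => sq_nonneg _) (fun i => sq_nonneg _) hsum' hmax' hmin'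

end Summit.CriticalPhenomena.Ising3DConformalLimit.Theorems
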